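import Summits.CriticalPhenomena.SAWScalingLimit.Theorems.SAWLoopFugacityFlowAvoidanceLimitAnchorDefs
import Mathlib.Analysis.Analytic.Constructions
import Mathlib.Analysis.Calculus.Deriv.Inv

/-!
# Structural facts for stub `stub_fugacityContinuation` of line `symplectic-fermion-anchor`
(crux `SAWLoopFugacityFlow.AvoidanceLimit`, stmt-CriticalPhenomena-10649) — helpers file

The stub `FugacityContinuation` (δ-uniform analyticity of the route's ratio
`z ↦ R_δ(z, z/2, Xc z)` in the complex loop fugacity on a neighbourhood `U ⊇ [-2+η, 0]`, along an
analytic continuation `Xc` of the intrinsic critical curve `s ↦ xcDim s (s/2)`) is an OPEN Lee–Yang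
type statement. This file lands the provable structural layer underneath it, for the objects of the
Defs module `…AvoidanceLimitAnchorDefs`:

* `dimerPF_edgeFugacity_zero`, `twoLegDim_edgeFugacity_zero`,
  `halfPlaneSusceptibilityDim_edgeFugacity_zero`, `chiCoeff_zero_right`: at edge fugacity `x = 0`
  the dressed partition function is `[A = ∅]`, so every denominator of the two-leg functions is `1`
  there, the half-plane susceptibility of every box is `1`, and the `0`-th Taylor coefficient is `1`;
* `differentiableOn_dimerPF`, `analyticAt_dimerPF` (over `ℝ` or `ℂ`): `Z_{n,t,x}(G, Λ; A)` is a
  polynomial expression in `(n, t, x)`, hence differentiable / analytic along differentiable /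
  analytic parameter curves (the dressed analogue of the tree's
  `DiluteLoopModel.differentiableOn_partitionFunction` of `DiluteLoopModelAnalyticity.lean`);
  `Rδ_eq_zero_of_dimerPF_eq_zero` (Lean's junk division: `R_δ = 0` AT a zero of any of its three
  denominators, so a pole of the honest ratio is a discontinuity of the total function);
  `differentiableOn_twoLegDim`, `differentiableOn_Rδ`, and the registered
  sub-goal `differentiableOn_ratio_of_dimerPF_ne_zero`: **the analyticity clause of
  `FugacityContinuation` REDUCES to zero-freeness of the three denominators**
  `Z^{conf}(Ω_δ; ∅)`, `Z(Ω_δ; {a} ∆ {b})`, `Z(Ω_δ; ∅)` on `U` along the curve `(z, z/2, Xc z)`;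
* `analyticAt_halfPlaneSusceptibilityDim`: the susceptibility of the box `Λ_N` is real-analytic at
  every fugacity where `Z(Λ_N; ∅) ≠ 0`, in particular at `x = 0` — so `chiCoeff n t k` is a genuine
  Taylor coefficient of an analytic germ, for ALL real `(n, t)` (signed weights included);
* `xcDim_mem_Icc`, `le_xcDim`, `bddAbove_of_lt_xcDim`, `xcDim_le`, `xcDim_eq_of_threshold`: the
  capped Cauchy–Hadamard supremum `xcDim n t` lies in `[0, 1]`, the bounded radii form a down-set,
  and `xcDim` is characterised as a threshold (the pattern of `stub_sawCriticalPoint`).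

Sources: N. Madras, G. Slade, *The Self-Avoiding Walk* (1993), §1.2–§1.3 (two-point function and
susceptibility as generating functions, radius of convergence) [MadrasSlade1993]; the polynomiality
is the tree's `DiluteLoopModel.map_partitionFunction` / `map_dimerPF` made quantitative. No new
definitions.
-/

noncomputable section

open scoped BigOperators Topology symmDiff
open Filter Finset
open Literature.Probability.RandomPlanarGeometry Literature.Probability.LatticeModels

namespace Summit.CriticalPhenomena.SAWScalingLimit.Theorems.AvoidanceLimit.Anchor

/-! ## Edge fugacity `x = 0`: all denominators are `1` -/

section EdgeFugacityZero

variable {K : Type*} [Field K]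

/-- **`Z_{n,t,0}(G, Λ; A) = [A = ∅]`**: at zero edge fugacity only the empty configuration (no
dimer, no edge) survives, and it is admissible iff the source set is empty. [folklore] -/
theorem dimerPF_edgeFugacity_zero (n t : K) (G : SimpleGraph (Site 2)) [G.LocallyFinite]
    (Λ A : Finset (Site 2)) : dimerPF n t 0 G Λ A = if A = ∅ then 1 else 0 := by
  classical
  have hmem : (∅ : Finset (Sym2 (Site 2))) ∈ dimerConfigs G Λ A := by simp [dimerConfigs]
  have hcov : covered Λ (∅ : Finset (Sym2 (Site 2))) = ∅ := by simp [covered]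
  rw [dimerPF, sum_eq_single_of_mem ∅ hmem]
  · rw [hcov, sdiff_empty, card_empty, pow_zero, one_mul]
    split_ifs with hA
    · subst hA
      exact DiluteLoopModel.partitionFunction_fugacity_zero n 0 Λ
    · rw [DiluteLoopModel.partitionFunction]
      refine sum_eq_zero fun F hF => sum_eq_zero fun S _ => ?_
      have hne : F ≠ ∅ := by
        rintro rfl
        rw [DiluteLoopModel.mem_configs] at hF
        apply hA
        rw [← hF.2]
        simp
      simp [DiluteLoopModel.weight, zero_pow (card_ne_zero.2 (nonempty_iff_ne_empty.2 hne))]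
  · intro M _ hM
    simp [zero_pow (card_ne_zero.2 (nonempty_iff_ne_empty.2 hM))]

/-- At `x = 0` the source-free partition function is `1` (the common denominator of the two-leg
functions does not vanish at the origin of the fugacity plane). [folklore] -/
theorem dimerPF_edgeFugacity_zero_empty (n t : K) (G : SimpleGraph (Site 2)) [G.LocallyFinite]
    (Λ : Finset (Site 2)) : dimerPF n t 0 G Λ ∅ = 1 := by
  rw [dimerPF_edgeFugacity_zero, if_pos rfl]

/-- At `x = 0` the normalised two-leg function is `[a = b]`. [folklore] -/
theorem twoLegDim_edgeFugacity_zero (n t : K) (G : SimpleGraph (Site 2)) [G.LocallyFinite]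
    (Λ : Finset (Site 2)) (a b : Site 2) : twoLegDim n t 0 G Λ a b = if a = b then 1 else 0 := by
  have hab : ({a} : Finset (Site 2)) ∆ {b} = ∅ ↔ a = b := by
    rw [← Finset.bot_eq_empty, symmDiff_eq_bot, Finset.singleton_inj]
  rw [twoLegDim, dimerPF_edgeFugacity_zero, dimerPF_edgeFugacity_zero_empty, div_one]
  by_cases h : a = b
  · rw [if_pos (hab.2 h), if_pos h]
  · rw [if_neg (fun h' => h (hab.1 h')), if_neg h]

/-- At `x = 0` the half-plane susceptibility of every box is `1` (only the trivial walk).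
[folklore] -/
theorem halfPlaneSusceptibilityDim_edgeFugacity_zero (n t : ℝ) (N : ℕ) :
    halfPlaneSusceptibilityDim n t 0 N = 1 := by
  rw [halfPlaneSusceptibilityDim]
  simp_rw [twoLegDim_edgeFugacity_zero]
  rw [sum_ite_eq]
  rw [if_pos (DiluteLoopModel.zero_mem_halfPlaneBox N)]

/-- The `0`-th Taylor coefficient of the half-plane two-leg series is `1` (the trivial walk), for all
real `(n, t)`. [folklore] -/
theorem chiCoeff_zero_right (n t : ℝ) : chiCoeff n t 0 = 1 := by
  rw [chiCoeff, iteratedDeriv_zero, Nat.factorial_zero, Nat.cast_one, div_one,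
    halfPlaneSusceptibilityDim_edgeFugacity_zero]

end EdgeFugacityZero

/-! ## Polynomiality made quantitative: differentiability and analyticity in the parameters -/

section Regularity

variable {𝕜 : Type*} [NontriviallyNormedField 𝕜]

/-- **`Z_{n,t,x}(G, Λ; A)` is differentiable along differentiable parameter curves**
`z ↦ (n(z), t(z), x(z))` on any set `U` (over `ℝ` or `ℂ`): it is a polynomial expression in
`(n, t, x)`. [folklore] -/
theorem differentiableOn_dimerPF {U : Set 𝕜} {f g h : 𝕜 → 𝕜}
    (hf : DifferentiableOn 𝕜 f U) (hg : DifferentiableOn 𝕜 g U) (hh : DifferentiableOn 𝕜 h U)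
    (G : SimpleGraph (Site 2)) [G.LocallyFinite] (Λ A : Finset (Site 2)) :
    DifferentiableOn 𝕜 (fun z => dimerPF (f z) (g z) (h z) G Λ A) U := by
  simp only [dimerPF, DiluteLoopModel.partitionFunction, DiluteLoopModel.weight]
  fun_prop

/-- **`Z_{n,t,x}(G, Λ; A)` is analytic along analytic parameter curves** (over `ℝ` or `ℂ`).
[folklore] -/
theorem analyticAt_dimerPF {f g h : 𝕜 → 𝕜} {z₀ : 𝕜}
    (hf : AnalyticAt 𝕜 f z₀) (hg : AnalyticAt 𝕜 g z₀) (hh : AnalyticAt 𝕜 h z₀)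
    (G : SimpleGraph (Site 2)) [G.LocallyFinite] (Λ A : Finset (Site 2)) :
    AnalyticAt 𝕜 (fun z => dimerPF (f z) (g z) (h z) G Λ A) z₀ := by
  simp only [dimerPF, DiluteLoopModel.partitionFunction, DiluteLoopModel.weight]
  fun_prop

/-- The normalised two-leg function is differentiable along differentiable parameter curves on any
set where its denominator `Z(G, Λ; ∅)` does not vanish. [folklore] -/
theorem differentiableOn_twoLegDim {U : Set 𝕜} {f g h : 𝕜 → 𝕜}
    (hf : DifferentiableOn 𝕜 f U) (hg : DifferentiableOn 𝕜 g U) (hh : DifferentiableOn 𝕜 h U)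
    (G : SimpleGraph (Site 2)) [G.LocallyFinite] (Λ : Finset (Site 2)) (a b : Site 2)
    (h₀ : ∀ z ∈ U, dimerPF (f z) (g z) (h z) G Λ ∅ ≠ 0) :
    DifferentiableOn 𝕜 (fun z => twoLegDim (f z) (g z) (h z) G Λ a b) U := by
  simp only [twoLegDim]
  exact (differentiableOn_dimerPF hf hg hh G Λ _).div (differentiableOn_dimerPF hf hg hh G Λ ∅) h₀

/-- The normalised two-leg function is analytic along analytic parameter curves at every point where
its denominator `Z(G, Λ; ∅)` does not vanish. [folklore] -/
theorem analyticAt_twoLegDim {f g h : 𝕜 → 𝕜} {z₀ : 𝕜}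
    (hf : AnalyticAt 𝕜 f z₀) (hg : AnalyticAt 𝕜 g z₀) (hh : AnalyticAt 𝕜 h z₀)
    (G : SimpleGraph (Site 2)) [G.LocallyFinite] (Λ : Finset (Site 2)) (a b : Site 2)
    (h₀ : dimerPF (f z₀) (g z₀) (h z₀) G Λ ∅ ≠ 0) :
    AnalyticAt 𝕜 (fun z => twoLegDim (f z) (g z) (h z) G Λ a b) z₀ := by
  simp only [twoLegDim]
  exact (analyticAt_dimerPF hf hg hh G Λ _).div (analyticAt_dimerPF hf hg hh G Λ ∅) h₀

/-- **Junk division**: the total function `R_δ` VANISHES wherever one of its three denominators does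
(`a / 0 = 0`). At an isolated zero of `Z^{conf}(Ω_δ; ∅)` or of `Z(Ω_δ; {a} ∆ {b})` — a pole of the
honest ratio — `R_δ` is therefore discontinuous, so differentiability of `z ↦ R_δ(z, z/2, Xc z)` on
an open set through such a point fails: zero-freeness is not only sufficient
(`differentiableOn_Rδ`) but essentially necessary. [folklore] -/
theorem Rδ_eq_zero_of_dimerPF_eq_zero {K : Type*} [Field K] (n t x : K) (Ω S : Set ℂ) (δ : ℝ)
    (a b : Site 2)
    (h : dimerPF n t x (confinedGraph Ω S δ) (meshDomainFinset Ω δ) ∅ = 0 ∨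
      dimerPF n t x (discreteDomainGraph Ω δ) (meshDomainFinset Ω δ) ({a} ∆ {b}) = 0 ∨
      dimerPF n t x (discreteDomainGraph Ω δ) (meshDomainFinset Ω δ) ∅ = 0) :
    Rδ n t x Ω S δ a b = 0 := by
  simp only [Rδ, ratioDim, twoLegDim]
  rcases h with h | h | h <;> simp [h]

/-- **The route's ratio `R_δ` is differentiable along differentiable parameter curves wherever its
three denominators do not vanish**: the source-free partition function of the CONFINED graph, and
both partition functions of `Ω_δ` (the two-leg one being the denominator of the outer ratio).
[folklore] -/
theorem differentiableOn_Rδ {U : Set 𝕜} {f g h : 𝕜 → 𝕜}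
    (hf : DifferentiableOn 𝕜 f U) (hg : DifferentiableOn 𝕜 g U) (hh : DifferentiableOn 𝕜 h U)
    (Ω S : Set ℂ) (δ : ℝ) (a b : Site 2)
    (h₁ : ∀ z ∈ U, dimerPF (f z) (g z) (h z) (confinedGraph Ω S δ) (meshDomainFinset Ω δ) ∅ ≠ 0)
    (h₂ : ∀ z ∈ U,
      dimerPF (f z) (g z) (h z) (discreteDomainGraph Ω δ) (meshDomainFinset Ω δ) ({a} ∆ {b}) ≠ 0)
    (h₃ : ∀ z ∈ U, dimerPF (f z) (g z) (h z) (discreteDomainGraph Ω δ) (meshDomainFinset Ω δ) ∅ ≠ 0) :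
    DifferentiableOn 𝕜 (fun z => Rδ (f z) (g z) (h z) Ω S δ a b) U := by
  simp only [Rδ, ratioDim]
  refine (differentiableOn_twoLegDim hf hg hh _ _ a b h₁).div
    (differentiableOn_twoLegDim hf hg hh _ _ a b h₃) fun z hz => ?_
  rw [twoLegDim]
  exact div_ne_zero (h₂ z hz) (h₃ z hz)

/-- **The half-plane susceptibility of the box `Λ_N` is real-analytic in the edge fugacity at every
point where `Z(ℤ², Λ_N; ∅) ≠ 0`** (a finite sum of quotients of polynomials with that common
denominator), for ALL real `(n, t)` — signed weights included. [cite: MadrasSlade1993, §1.2–§1.3] -/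
theorem analyticAt_halfPlaneSusceptibilityDim (n t : ℝ) (N : ℕ) {x₀ : ℝ}
    (h₀ : dimerPF n t x₀ (zdGraph 2) (DiluteLoopModel.halfPlaneBox N) ∅ ≠ 0) :
    AnalyticAt ℝ (fun x => halfPlaneSusceptibilityDim n t x N) x₀ := by
  simp only [halfPlaneSusceptibilityDim]
  refine Finset.analyticAt_fun_sum _ fun b _ => ?_
  exact analyticAt_twoLegDim analyticAt_const analyticAt_const analyticAt_id _ _ _ _ h₀

/-- In particular the susceptibility of every box is real-analytic at `x = 0` (its denominator is `1`
there, `dimerPF_edgeFugacity_zero_empty`): `chiCoeff n t k`, the `k`-th derivative at `0` over `k!`,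
is a genuine Taylor coefficient of an analytic germ. [cite: MadrasSlade1993, §1.2–§1.3] -/
theorem analyticAt_halfPlaneSusceptibilityDim_zero (n t : ℝ) (N : ℕ) :
    AnalyticAt ℝ (fun x => halfPlaneSusceptibilityDim n t x N) 0 :=
  analyticAt_halfPlaneSusceptibilityDim n t N (by rw [dimerPF_edgeFugacity_zero_empty]; exact one_ne_zero)

/-- The source-free partition function does not vanish for small edge fugacity (it is `1` at `x = 0`
and continuous), along any parameter curves continuous at the base point. [folklore] -/
theorem eventually_dimerPF_empty_ne_zero {f g h : 𝕜 → 𝕜} {z₀ : 𝕜}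
    (hf : ContinuousAt f z₀) (hg : ContinuousAt g z₀) (hh : ContinuousAt h z₀) (hx : h z₀ = 0)
    (G : SimpleGraph (Site 2)) [G.LocallyFinite] (Λ : Finset (Site 2)) :
    ∀ᶠ z in 𝓝 z₀, dimerPF (f z) (g z) (h z) G Λ ∅ ≠ 0 := by
  have hc : ContinuousAt (fun z => dimerPF (f z) (g z) (h z) G Λ ∅) z₀ := by
    simp only [dimerPF, DiluteLoopModel.partitionFunction, DiluteLoopModel.weight]
    fun_prop
  refine hc.eventually_ne ?_
  rw [hx, dimerPF_edgeFugacity_zero_empty]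
  exact one_ne_zero

end Regularity

/-! ## The capped Cauchy–Hadamard supremum `xcDim` -/

section CriticalCurve

/-- At radius `0` the sequence `|chiCoeff n t k| · 0^k` is bounded (by its `k = 0` term). [folklore] -/
theorem bddAbove_chiCoeff_mul_zero_pow (n t : ℝ) :
    BddAbove (Set.range fun k : ℕ => |chiCoeff n t k| * (0 : ℝ) ^ k) := by
  refine ⟨|chiCoeff n t 0|, ?_⟩
  rintro _ ⟨k, rfl⟩
  rcases Nat.eq_zero_or_pos k with rfl | hk
  · simp
  · simp [zero_pow hk.ne']

/-- The bounded radii form a down-set: if `|chiCoeff n t k| r^k` is bounded and `0 ≤ r' ≤ r`, then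
`|chiCoeff n t k| r'^k` is bounded. [folklore] -/
theorem bddAbove_chiCoeff_mul_pow_mono {n t r r' : ℝ} (hr' : 0 ≤ r') (hle : r' ≤ r)
    (h : BddAbove (Set.range fun k : ℕ => |chiCoeff n t k| * r ^ k)) :
    BddAbove (Set.range fun k : ℕ => |chiCoeff n t k| * r' ^ k) := by
  obtain ⟨B, hB⟩ := h
  refine ⟨B, ?_⟩
  rintro _ ⟨k, rfl⟩
  exact (mul_le_mul_of_nonneg_left (pow_le_pow_left₀ hr' hle k) (abs_nonneg _)).trans (hB ⟨k, rfl⟩)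

/-- **`0 ≤ x_c(n, t) ≤ 1`** for all real `(n, t)`: the defining set contains `0` and lies in
`[0, 1]`. [folklore] -/
theorem xcDim_mem_Icc (n t : ℝ) : xcDim n t ∈ Set.Icc 0 1 := by
  have h0 : (0 : ℝ) ∈ {r : ℝ | 0 ≤ r ∧ r ≤ 1 ∧
      BddAbove (Set.range fun k : ℕ => |chiCoeff n t k| * r ^ k)} :=
    ⟨le_rfl, zero_le_one, bddAbove_chiCoeff_mul_zero_pow n t⟩
  have hb : BddAbove {r : ℝ | 0 ≤ r ∧ r ≤ 1 ∧
      BddAbove (Set.range fun k : ℕ => |chiCoeff n t k| * r ^ k)} := ⟨1, fun r hr => hr.2.1⟩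
  exact ⟨le_csSup hb h0, csSup_le ⟨0, h0⟩ fun r hr => hr.2.1⟩

/-- A radius in `[0, 1]` at which the sequence is bounded lies below `x_c`. [folklore] -/
theorem le_xcDim {n t r : ℝ} (hr0 : 0 ≤ r) (hr1 : r ≤ 1)
    (h : BddAbove (Set.range fun k : ℕ => |chiCoeff n t k| * r ^ k)) : r ≤ xcDim n t :=
  le_csSup ⟨1, fun _ hr => hr.2.1⟩ ⟨hr0, hr1, h⟩

/-- Strictly below `x_c` the sequence `|chiCoeff n t k| r^k` is bounded. [folklore] -/
theorem bddAbove_of_lt_xcDim {n t r : ℝ} (hr0 : 0 ≤ r) (h : r < xcDim n t) :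
    BddAbove (Set.range fun k : ℕ => |chiCoeff n t k| * r ^ k) := by
  have h0 : (0 : ℝ) ∈ {r : ℝ | 0 ≤ r ∧ r ≤ 1 ∧
      BddAbove (Set.range fun k : ℕ => |chiCoeff n t k| * r ^ k)} :=
    ⟨le_rfl, zero_le_one, bddAbove_chiCoeff_mul_zero_pow n t⟩
  obtain ⟨r', hr', hrr'⟩ := exists_lt_of_lt_csSup ⟨0, h0⟩ h
  exact bddAbove_chiCoeff_mul_pow_mono hr0 hrr'.le hr'.2.2

/-- An upper bound for every bounded radius in `[0, 1]` bounds `x_c`. [folklore] -/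
theorem xcDim_le {n t ρ : ℝ}
    (h : ∀ r : ℝ, 0 ≤ r → r ≤ 1 → BddAbove (Set.range fun k : ℕ => |chiCoeff n t k| * r ^ k) → r ≤ ρ) :
    xcDim n t ≤ ρ :=
  csSup_le ⟨0, le_rfl, zero_le_one, bddAbove_chiCoeff_mul_zero_pow n t⟩ fun r hr => h r hr.1 hr.2.1 hr.2.2

/-- **Threshold characterisation of `x_c`**: if `ρ ≤ 1`, the sequence is bounded at every radius
`0 ≤ r < ρ` and unbounded at every radius `ρ < r ≤ 1`, then `x_c(n, t) = ρ` (whatever happens AT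
`ρ`; `0 ≤ ρ` follows, the radius `0` being bounded; the pattern by which `x_c(0, 0) = 1/μ` is
proved). [cite: MadrasSlade1993, §1.2–§1.3] -/
theorem xcDim_eq_of_threshold {n t ρ : ℝ} (hρ1 : ρ ≤ 1)
    (hlt : ∀ r : ℝ, 0 ≤ r → r < ρ → BddAbove (Set.range fun k : ℕ => |chiCoeff n t k| * r ^ k))
    (hgt : ∀ r : ℝ, ρ < r → r ≤ 1 → ¬ BddAbove (Set.range fun k : ℕ => |chiCoeff n t k| * r ^ k)) :
    xcDim n t = ρ := by
  refine le_antisymm (xcDim_le fun r _ hr1 hb => ?_) (le_of_forall_lt fun c hc => ?_)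
  · by_contra hlt'
    exact hgt r (lt_of_not_ge hlt') hr1 hb
  · rcases lt_or_ge c 0 with hc0 | hc0
    · exact hc0.trans_le (xcDim_mem_Icc n t).1
    · obtain ⟨r, hcr, hrρ⟩ := exists_between hc
      exact hcr.trans_le (le_xcDim (hc0.trans hcr.le) (hrρ.le.trans hρ1) (hlt r (hc0.trans hcr.le) hrρ))

end CriticalCurve

/-! ## Registered sub-goal -/

/-- Registered sub-goal of this helpers file (stub `stub_fugacityContinuation`): **the analyticity
clause of `FugacityContinuation` reduces to zero-freeness.** Along any curve `z ↦ (z, z/2, Xc z)` with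
`Xc` differentiable on `U`, the complex ratio `z ↦ R_δ(z, z/2, Xc z; Ω, S)` is differentiable on `U`
as soon as the three denominators `Z^{conf}(Ω_δ; ∅)`, `Z(Ω_δ; {a} ∆ {b})`, `Z(Ω_δ; ∅)` do not vanish
on `U` (no openness or connectedness needed). The δ-UNIFORM zero-freeness itself, and the δ-uniform
bound, are the open Lee–Yang content of the stub. [folklore] -/
theorem differentiableOn_ratio_of_dimerPF_ne_zero :
    ∀ (U : Set ℂ) (Xc : ℂ → ℂ), DifferentiableOn ℂ Xc U →
      ∀ (Ω S : Set ℂ) (δ : ℝ) (a b : Site 2),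
        (∀ z ∈ U, dimerPF z (z / 2) (Xc z) (confinedGraph Ω S δ) (meshDomainFinset Ω δ) ∅ ≠ 0) →
        (∀ z ∈ U,
          dimerPF z (z / 2) (Xc z) (discreteDomainGraph Ω δ) (meshDomainFinset Ω δ) ({a} ∆ {b}) ≠ 0) →
        (∀ z ∈ U, dimerPF z (z / 2) (Xc z) (discreteDomainGraph Ω δ) (meshDomainFinset Ω δ) ∅ ≠ 0) →
        DifferentiableOn ℂ (fun z : ℂ => Rδ z (z / 2) (Xc z) Ω S δ a b) U :=
  fun _ _ hXc Ω S δ a b h₁ h₂ h₃ =>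
    differentiableOn_Rδ differentiableOn_id (differentiableOn_id.div_const 2) hXc Ω S δ a b h₁ h₂ h₃

end Summit.CriticalPhenomena.SAWScalingLimit.Theorems.AvoidanceLimit.Anchor

end
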